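import Mathlib
import Summits.Schanuel.Schanuel.Theorems.AclSubsetLogFreeCore.Negative.LogFreeCoreObjects
import Literature.ModelTheory.ExponentialFields.DefinabilityParams
import Literature.NumberTheory.Transcendental.PeriodsWave0NesterenkoProofs
import Literature.NumberTheory.Transcendental.PeriodsWave0Proofs

/-!
# Crux `AclSubsetLogFreeCore` — `∅`-definability in `ℂ_exp`; the `exp`-closure of the core is load-bearing (Nesterenko)

Theorems for the crux (A) `RigidCore.AclSubsetLogFreeCore` (stmt-Schanuel-0968), all proved:

* an `∅`-definability kit for `(ℂ, +, ·, −, 0, 1, exp)` over Mathlib's `Set.Definable`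
  (`definableFun_cexp/add'/mul'/neg'/natCast'/intCast'`, `definableFun_reindex`,
  `definable_mem_of_definable₁`);
* the classical `∅`-definable sets: `ℤ` (`definable₁_int`, so `ℂ_exp` is not minimal), `{±2πi}`
  (`definable₁_kerGens`), and POINTWISE `π, e^π, e ∈ dcl^{ℂ_exp}(∅)` (KMO 2012 §2);
* Nesterenko in `ℂ`: `algebraicIndependent_pi_exp_pi`, `exp_pi_not_mem_Kpi`;
* LOAD-BEARING: `aclSubsetLogFreeCore_false_without_expClosed` — (A) with the `exp`-closure of
  the core dropped (core `= ℚ(π)^{ralg} ∋ 2πi`) is FALSE at `e^π ∈ dcl(∅)`; and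
  `aclSubsetLogFreeCore_false_without_period_and_exp` — `acl^{ℂ_exp}(∅) ⊄ ℚ̄` (at `e`), unlike
  the pure field `(ℂ, +, ·)`.  So every proof of (A) must use that `C_EA` is `exp`-closed.

## References

* [KirbyMacintyreOnshuus2012] J. Kirby, A. Macintyre, A. Onshuus, *The algebraic numbers definable
  in various exponential fields*, J. Inst. Math. Jussieu 11 (2012) 825–834, arXiv:1101.4224, §2
  (`ℤ`, `ℚ`, `±2πi`, `π` parameter-free definable in any E-field with cyclic kernel).
* [Nesterenko1996SbMath] Yu. V. Nesterenko, *Modular functions and transcendence questions*,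
  Sb. Math. 187 (1996) 1319–1348, Theorem 1 (`π, e^π, Γ(1/4)` algebraically independent;
  tree theorem `nesterenko_holds`).
* [Marker2002] D. Marker, *Model Theory: An Introduction*, Springer GTM 217, §1.3 and
  Exercise 1.4.10 (`acl`, `dcl`; symmetric functions of finite definable sets).
-/

noncomputable section

open FirstOrder FirstOrder.Language Set
open Literature.ModelTheory.ExponentialFields

namespace Summit.Schanuel.Schanuel.Theorems.AclSubsetLogFreeCore.Negative

variable {α β : Type*} {A : Set ℂ}

/-- Re-indexing the arguments of a definable function keeps it definable (no finiteness needed). -/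
theorem definableFun_reindex {g : (α → ℂ) → ℂ} (hg : A.DefinableFun Language.expRing g)
    (ι : α → β) : A.DefinableFun Language.expRing (fun w : β → ℂ => g (w ∘ ι)) := by
  have h := hg.preimage_comp (Option.map ι)
  unfold Set.DefinableFun
  convert h using 1
  ext v
  simp only [Function.tupleGraph, mem_setOf_eq, mem_preimage]
  exact Iff.rfl

/-- `exp` of a definable function is definable. [folklore] -/
theorem definableFun_cexp {g : (α → ℂ) → ℂ} (hg : A.DefinableFun Language.expRing g) :
    A.DefinableFun Language.expRing (fun v => Complex.exp (g v)) := by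
  have h := ((Set.DefinableFun.fun_symbol (L := Language.expRing) (M := ℂ)
    (expRingFunc.exp : Language.expRing.Functions 1)).of_empty (A := A)).comp
    (g := fun v (_ : Fin 1) => g v) (fun _ => hg)
  simpa using h

/-- Sum of definable functions is definable. [folklore] -/
theorem definableFun_add' {g h : (α → ℂ) → ℂ} (hg : A.DefinableFun Language.expRing g)
    (hh : A.DefinableFun Language.expRing h) :
    A.DefinableFun Language.expRing (fun v => g v + h v) := by
  have hF : A.DefinableMap Language.expRing (fun v => ![g v, h v]) := by
    intro i; fin_cases i <;> simpa
  have := ((Set.DefinableFun.fun_symbol (L := Language.expRing) (M := ℂ)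
    (expRingFunc.add : Language.expRing.Functions 2)).of_empty (A := A)).comp hF
  simpa using this

/-- Product of definable functions is definable. [folklore] -/
theorem definableFun_mul' {g h : (α → ℂ) → ℂ} (hg : A.DefinableFun Language.expRing g)
    (hh : A.DefinableFun Language.expRing h) :
    A.DefinableFun Language.expRing (fun v => g v * h v) := by
  have hF : A.DefinableMap Language.expRing (fun v => ![g v, h v]) := by
    intro i; fin_cases i <;> simpa
  have := ((Set.DefinableFun.fun_symbol (L := Language.expRing) (M := ℂ)
    (expRingFunc.mul : Language.expRing.Functions 2)).of_empty (A := A)).comp hF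
  simpa using this

/-- Negation of a definable function is definable. [folklore] -/
theorem definableFun_neg' {g : (α → ℂ) → ℂ} (hg : A.DefinableFun Language.expRing g) :
    A.DefinableFun Language.expRing (fun v => -g v) := by
  have h := ((Set.DefinableFun.fun_symbol (L := Language.expRing) (M := ℂ)
    (expRingFunc.neg : Language.expRing.Functions 1)).of_empty (A := A)).comp
    (g := fun v (_ : Fin 1) => g v) (fun _ => hg)
  simpa using h

/-- The constant `0` is a definable function. [folklore] -/
theorem definableFun_zero' : A.DefinableFun Language.expRing (fun _ : α → ℂ => (0 : ℂ)) := by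
  have h := ((Set.DefinableFun.fun_symbol (L := Language.expRing) (M := ℂ)
    (expRingFunc.zero : Language.expRing.Functions 0)).of_empty (A := A)).comp
    (g := fun (_ : α → ℂ) (i : Fin 0) => (i.elim0 : ℂ)) (fun i => i.elim0)
  simpa using h

/-- The constant `1` is a definable function. [folklore] -/
theorem definableFun_one' : A.DefinableFun Language.expRing (fun _ : α → ℂ => (1 : ℂ)) := by
  have h := ((Set.DefinableFun.fun_symbol (L := Language.expRing) (M := ℂ)
    (expRingFunc.one : Language.expRing.Functions 0)).of_empty (A := A)).comp
    (g := fun (_ : α → ℂ) (i : Fin 0) => (i.elim0 : ℂ)) (fun i => i.elim0)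
  simpa using h

/-- Natural-number constants are `∅`-definable functions. [folklore] -/
theorem definableFun_natCast' (n : ℕ) :
    A.DefinableFun Language.expRing (fun _ : α → ℂ => (n : ℂ)) := by
  induction n with
  | zero => simpa using (definableFun_zero' (A := A) (α := α))
  | succ n ih => simpa [Nat.cast_succ] using definableFun_add' ih definableFun_one'

/-- Integer constants are `∅`-definable functions. [folklore] -/
theorem definableFun_intCast' (n : ℤ) :
    A.DefinableFun Language.expRing (fun _ : α → ℂ => (n : ℂ)) := by
  cases n with
  | ofNat n => simpa using (definableFun_natCast' (A := A) (α := α) n)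
  | negSucc n =>
    simpa [Int.cast_negSucc] using definableFun_neg' (definableFun_natCast' (A := A) (α := α) (n + 1))

/-- Atom `g v ∈ s` for an `A`-definable set `s ⊆ ℂ` and an `A`-definable function `g`. -/
theorem definable_mem_of_definable₁ {s : Set ℂ} (hs : A.Definable₁ Language.expRing s)
    {g : (α → ℂ) → ℂ} (hg : A.DefinableFun Language.expRing g) :
    A.Definable Language.expRing {v : α → ℂ | g v ∈ s} := by
  have hF : A.DefinableMap Language.expRing (fun v (_ : Fin 1) => g v) := fun _ => hg
  exact hs.preimage_map hF

/-- `g v ∈ ℤ` is a definable condition for definable `g`. [cite: KirbyMacintyreOnshuus2012, §2.2] -/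
theorem definable_mem_intSet {g : (α → ℂ) → ℂ} (hg : A.DefinableFun Language.expRing g) :
    A.Definable Language.expRing {v : α → ℂ | g v ∈ intSet} := by
  simp only [intSet, Set.mem_setOf_eq]
  refine definable_setOf_forall_params (definable_setOf_imp_params ?_ ?_)
  · exact definable_setOf_eq_params (definableFun_cexp (definableFun_proj_params _))
      definableFun_one'
  · exact definable_setOf_eq_params
      (definableFun_cexp (definableFun_mul' (definableFun_reindex hg Sum.inl)
        (definableFun_proj_params _))) definableFun_one'

/-- `g v` generates the kernel' is a definable condition for definable `g`. [cite: KirbyMacintyreOnshuus2012, §2.3] -/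
theorem definable_mem_kerGenSet {g : (α → ℂ) → ℂ} (hg : A.DefinableFun Language.expRing g) :
    A.Definable Language.expRing {v : α → ℂ | g v ∈ kerGenSet} := by
  simp only [kerGenSet, Set.mem_setOf_eq]
  refine definable_setOf_and_params ?_ ?_
  · exact definable_setOf_eq_params (definableFun_cexp hg) definableFun_one'
  · refine definable_setOf_forall_params (definable_setOf_imp_params ?_ ?_)
    · exact definable_setOf_eq_params (definableFun_cexp (definableFun_proj_params _))
        definableFun_one'
    · refine definable_setOf_exists_params (definable_setOf_and_params ?_ ?_)
      · exact definable_mem_intSet (definableFun_proj_params _)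
      · exact definable_setOf_eq_params (definableFun_proj_params _)
          (definableFun_mul' (definableFun_proj_params _)
            (definableFun_reindex hg (Sum.inl ∘ Sum.inl)))

/-- `ℤ ⊆ ℂ` is `∅`-definable in `ℂ_exp` (so `ℂ_exp` is not minimal: an infinite, co-infinite
`∅`-definable set). [cite: KirbyMacintyreOnshuus2012, §2.2] -/
theorem definable₁_int :
    Set.Definable₁ (∅ : Set ℂ) Language.expRing (Set.range (Int.cast : ℤ → ℂ)) := by
  have h := definable_mem_intSet (A := (∅ : Set ℂ)) (definableFun_proj_params (α := Fin 1) 0)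
  have e : {x : Fin 1 → ℂ | x 0 ∈ Set.range (Int.cast : ℤ → ℂ)} = {v | v 0 ∈ intSet} := by
    ext v; simp [mem_intSet_iff, eq_comm]
  unfold Set.Definable₁; rw [e]; exact h

/-- `{2πi, −2πi}` is a finite `∅`-definable set. [cite: KirbyMacintyreOnshuus2012, §2.3] -/
theorem definable₁_kerGens :
    Set.Definable₁ (∅ : Set ℂ) Language.expRing
      ({2 * ↑Real.pi * Complex.I, -(2 * ↑Real.pi * Complex.I)} : Set ℂ) := by
  have h := definable_mem_kerGenSet (A := (∅ : Set ℂ)) (definableFun_proj_params (α := Fin 1) 0)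
  have e : {x : Fin 1 → ℂ | x 0 ∈ ({2 * ↑Real.pi * Complex.I, -(2 * ↑Real.pi * Complex.I)} :
      Set ℂ)} = {v | v 0 ∈ kerGenSet} := by
    ext v; simp [mem_kerGenSet_iff]
  unfold Set.Definable₁; rw [e]; exact h

/-- `2πi ∈ acl^{ℂ_exp}(∅)`. [cite: KirbyMacintyreOnshuus2012, §2.3] -/
theorem two_pi_I_mem_expAcl : (2 * ↑Real.pi * Complex.I : ℂ) ∈ expAcl :=
  ⟨_, (Set.finite_singleton _).insert _, definable₁_kerGens, by simp⟩

/-- `g v = π` (through the `π`-formula) is a definable condition. [cite: KirbyMacintyreOnshuus2012, §2.5] -/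
theorem definable_mem_piSet {g : (α → ℂ) → ℂ} (hg : A.DefinableFun Language.expRing g) :
    A.Definable Language.expRing {v : α → ℂ | g v ∈ piSet} := by
  simp only [piSet, Set.mem_setOf_eq]
  refine definable_setOf_exists_params (definable_setOf_and_params ?_ ?_)
  · exact definable_mem_kerGenSet (definableFun_proj_params _)
  · refine definable_setOf_exists_params (definable_setOf_and_params ?_ ?_)
    · exact definable_setOf_eq_params
        (definableFun_add' (definableFun_add' (definableFun_add' (definableFun_proj_params _)
          (definableFun_proj_params _)) (definableFun_proj_params _))
          (definableFun_proj_params _))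
        (definableFun_proj_params _)
    · exact definable_setOf_eq_params
        (definableFun_add'
          (definableFun_mul' (definableFun_cexp (definableFun_proj_params _))
            (definableFun_reindex hg (Sum.inl ∘ Sum.inl)))
          (definableFun_mul' (definableFun_cexp (definableFun_proj_params _))
            (definableFun_reindex hg (Sum.inl ∘ Sum.inl))))
        (definableFun_proj_params _)

/-- `π ∈ dcl^{ℂ_exp}(∅)`. [cite: KirbyMacintyreOnshuus2012, §2.5] -/
theorem pi_mem_expDcl : (Real.pi : ℂ) ∈ expDcl := by
  have h := definable_mem_piSet (A := (∅ : Set ℂ)) (definableFun_proj_params (α := Fin 1) 0)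
  have e : {x : Fin 1 → ℂ | x 0 ∈ ({(Real.pi : ℂ)} : Set ℂ)} = {v | v 0 ∈ piSet} := by
    ext v; simp [mem_piSet_iff]
  show Set.Definable₁ _ _ _
  unfold Set.Definable₁; rw [e]; exact h

/-- `e^π ∈ dcl^{ℂ_exp}(∅)` (`x = e^π ⟺ ∃ y (y = π ∧ x = e^y)`). -/
theorem exp_pi_mem_expDcl : Complex.exp Real.pi ∈ expDcl := by
  have h : (∅ : Set ℂ).Definable Language.expRing
      {v : Fin 1 → ℂ | ∃ y, y ∈ piSet ∧ v 0 = Complex.exp y} := by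
    refine definable_setOf_exists_params (definable_setOf_and_params ?_ ?_)
    · exact definable_mem_piSet (definableFun_proj_params _)
    · exact definable_setOf_eq_params (definableFun_proj_params _)
        (definableFun_cexp (definableFun_proj_params _))
  have e : {x : Fin 1 → ℂ | x 0 ∈ ({Complex.exp Real.pi} : Set ℂ)} =
      {v : Fin 1 → ℂ | ∃ y, y ∈ piSet ∧ v 0 = Complex.exp y} := by
    ext v; simp [mem_piSet_iff]
  show Set.Definable₁ _ _ _
  unfold Set.Definable₁; rw [e]; exact h

/-- `e ∈ dcl^{ℂ_exp}(∅)` by the quantifier-free formula `x = exp 1`. -/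
theorem e_mem_expDcl : Complex.exp 1 ∈ expDcl := by
  have h : (∅ : Set ℂ).Definable Language.expRing {v : Fin 1 → ℂ | v 0 = Complex.exp 1} :=
    definable_setOf_eq_params (definableFun_proj_params _) (definableFun_cexp definableFun_one')
  have e : {x : Fin 1 → ℂ | x 0 ∈ ({Complex.exp 1} : Set ℂ)} =
      {v : Fin 1 → ℂ | v 0 = Complex.exp 1} := by
    ext v; simp
  show Set.Definable₁ _ _ _
  unfold Set.Definable₁; rw [e]; exact h

/-- `π ∈ acl^{ℂ_exp}(∅)`. [cite: KirbyMacintyreOnshuus2012, §2.5] -/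
theorem pi_mem_expAcl : (Real.pi : ℂ) ∈ expAcl := expDcl_subset_expAcl pi_mem_expDcl

/-- `e^π ∈ acl^{ℂ_exp}(∅)`. [folklore] -/
theorem exp_pi_mem_expAcl : Complex.exp Real.pi ∈ expAcl := expDcl_subset_expAcl exp_pi_mem_expDcl

/-- `e ∈ acl^{ℂ_exp}(∅)`. [folklore] -/
theorem e_mem_expAcl : Complex.exp 1 ∈ expAcl := expDcl_subset_expAcl e_mem_expDcl

/-- Nesterenko 1996 (tree theorem `nesterenko_holds`: `π, e^π, Γ(1/4)` algebraically independent)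
restricted to `π, e^π` and pushed into `ℂ`. -/
theorem algebraicIndependent_pi_exp_pi :
    AlgebraicIndependent ℚ ![(Real.pi : ℂ), Complex.exp Real.pi] := by
  have h3 : AlgebraicIndependent ℚ ![Real.pi, Real.exp Real.pi, Real.Gamma (1 / 4)] :=
    Literature.NumberTheory.Transcendental.nesterenko_holds
  have h2 : AlgebraicIndependent ℚ ![Real.pi, Real.exp Real.pi] := by
    have := h3.comp Fin.castSucc (Fin.castSucc_injective 2)
    convert this using 1
    ext i; fin_cases i <;> rfl
  have hf : Function.Injective ((Complex.ofRealHom).toRatAlgHom) := fun a b h =>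
    Complex.ofReal_injective (by simpa using h)
  have hmap := h2.map' (f := (Complex.ofRealHom).toRatAlgHom) hf
  convert hmap using 1
  ext i; fin_cases i <;> simp [Complex.ofReal_exp]

/-- `e^π` is not algebraic over `ℚ(π)` (Nesterenko). [cite: Nesterenko1996SbMath] -/
theorem exp_pi_not_isAlgebraic_adjoin_pi :
    ¬ IsAlgebraic (IntermediateField.adjoin ℚ {(Real.pi : ℂ)}) (Complex.exp Real.pi) := by
  rw [IntermediateField.isAlgebraic_adjoin_iff]
  have h := algebraicIndependent_pi_exp_pi.transcendental_adjoin (s := {0}) (i := 1) (by simp)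
  have hs : ((![(Real.pi : ℂ), Complex.exp Real.pi]) '' ({0} : Set (Fin 2))) = {(Real.pi : ℂ)} := by
    simp
  rw [hs] at h
  simpa [Transcendental] using h

/-- `e^π ∉ ℚ(π)^{ralg}` (Nesterenko). [cite: Nesterenko1996SbMath] -/
theorem exp_pi_not_mem_Kpi : Complex.exp Real.pi ∉ Kpi := by
  rw [Kpi, mem_relAlg_iff]; exact exp_pi_not_isAlgebraic_adjoin_pi

/-- **Any proof of (A) must use the `exp`-CLOSURE of `C_EA`** (Nesterenko): with it dropped the
inclusion fails at `e^π ∈ dcl(∅)`, since `e^π ∉ ℚ(π)^{ralg} ∋ 2πi`. [cite: Nesterenko1996SbMath] -/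
theorem aclSubsetLogFreeCore_false_without_expClosed :
    ¬ (∀ a : ℂ, a ∈ expAcl → a ∈ sInf coreFamilyNoExp) := fun h => by
  have h1 := IntermediateField.mem_sInf.1 (h _ exp_pi_mem_expAcl) Kpi Kpi_mem_coreFamilyNoExp
  exact exp_pi_not_mem_Kpi h1

/-- With BOTH transcendental inputs of the core dropped (no `2πi`, no `exp`) the core becomes
`ℚ̄ ∩ ℂ` ("acl(∅) consists of algebraic numbers", true in the pure field `(ℂ, +, ·)`): false in
`ℂ_exp` at `e = exp 1 ∈ dcl(∅)` (Hermite, tree `transcendental_rat_cexp_one`). -/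
theorem aclSubsetLogFreeCore_false_without_period_and_exp :
    ¬ (∀ a : ℂ, a ∈ expAcl → IsAlgebraic ℚ a) := fun h =>
  Literature.NumberTheory.Transcendental.transcendental_rat_cexp_one (h _ e_mem_expAcl)

end Summit.Schanuel.Schanuel.Theorems.AclSubsetLogFreeCore.Negative
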